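import Summits.Ventures.CertifiedManyBodySolver.Upper.IntervalReaderHubbardKernel
import Summits.Ventures.CertifiedManyBodySolver.Upper.IntervalReaderH1

/-!
# Ventures/CertifiedManyBodySolver — Upper/IntervalReaderSentence.lean: bytes ⇒ the certificate sentence
(part 17 of the Theorem-H1′ package; parts 1–16: `IntervalReaderSchur` … `IntervalReaderE1Tables`)

HONEST FRAMING: first certified bounds; not a superconductivity verdict; every number certified or labelled
float.  This file composes already-landed theorems; it certifies no number, moves no row, and says nothing about
the Hubbard model's spectrum in the thermodynamic limit or about any order parameter.  Its conclusion is the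
finite-box VARIATIONAL sentence `⟨ψ|H|ψ⟩ ≤ E·⟨ψ|ψ⟩` of one witness — a ceiling on a box ground-state energy, never
an order-parameter word (LADDER v1.17 (i)).

THE CAPSTONE.  The interval lineage's reader (`h1sweep.py` / `grid_main.py`, l3core 0.6.9) runs two sweeps over
the witness bytes of a FORMAT-mps1 certificate — the `H`-chain through E1's automaton (`strans`) and the `Nrm`
chain (identity words) — prints an upward-rounded radius for each, and says ACCEPT iff the high corner of the
quotient interval is `≤ E` (`accept_sound`, part 3, by value).  `certificate_sentence_of_reader` states, in one
theorem and in the tree's vocabulary, what that ACCEPT means for the ACTUAL witness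
`ψ = mpsOpenVar N A l r` of the certificate and the ACTUAL operator `toSpin (hamiltonian G t U)` of any finite
graph `G` on the enumeration order:

GIVEN (bytes only) — for the `H`-sweep over `graphAutomaton G t U` (part 14): Gram constants `κ`, operator
constants `M`, computed environment families `YH` with per-step `‖·‖₂` defects `≤ ρH`, radii `radH` obeying the
code's recursion from the exact rank-one boundary (part 12's hypotheses, dead channels at `0` by part 14); for the
`Nrm`-sweep (site words `1`): computed environments `YN`, defects `ρN`, radii `radN` likewise; and the reader's
final by-value comparison in the shape of `accept_sound` (with `den = 1`):
`hh + rh ≤ E·(nh − rn)` and `hh + rh ≤ E·(nh + rn)`, where `hh, nh` are the real parts of the two numbers the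
reader pairs out of its last environments and `rh = (Σ‖r i‖)²·radH_N FINAL`, `rn = (Σ‖r i‖)²·radN_N` —
THEN `Re ⟨ψ, toSpin (hamiltonian G t U) ψ⟩ ≤ E · Re ⟨ψ, ψ⟩`.

(Proof: parts 15 + 12 enclose the two complex numbers; `|Re z| ≤ ‖z‖`; part 3's `accept_sound`.)  With parts
8/10 (`fmps_sentence_iff_sweeps`, `boxMps_sentence_iff_sweeps`) this is the `hE` hypothesis the FORMAT-mps1
consumers (`FMPSConsumer`, `Theorems/R2cBoxMpsConsumer`) take, up to their Fock relabelling.  What is NOT a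
hypothesis any more: anything about what the automaton represents.  What remains a hypothesis: the per-step defect
bounds — i.e. that the code's integer GEMMs and rounding bookkeeping are what the code asserts (self-tests, blind
planted suites, non-author replays), and the contraction values themselves (kit jobs).
-/

noncomputable section

open Matrix Finset WithLp
open scoped BigOperators ComplexOrder Matrix.Norms.L2Operator

namespace Summit.Ventures.CertifiedManyBodySolver.Upper.IntervalReader

open Literature.MathematicalPhysics.QuantumLattice
open Literature.MathematicalPhysics.QuantumLattice.JordanWigner

variable {N D : ℕ}

/-- Real parts inherit a complex enclosure: `‖a − z‖ ≤ ρ ⇒ |Re z − Re a| ≤ ρ`. -/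
theorem abs_re_sub_re_le_of_norm_sub_le {a z : ℂ} {ρ : ℝ} (h : ‖a - z‖ ≤ ρ) : |z.re - a.re| ≤ ρ := by
  rw [abs_sub_comm, ← Complex.sub_re]
  exact (Complex.abs_re_le_norm _).trans h

/-- The `Nrm` chain: the identity operator has the all-ones product kernel. -/
theorem one_apply_eq_prod_one (σ τ : TensorIndex (Fin N) 4) :
    (1 : Op (Fin N) 4) σ τ = ∏ k : Fin N, (fun _ : Fin N => (1 : Matrix (Fin 4) (Fin 4) ℂ)) k (σ k) (τ k) := by
  rw [← productOp_apply, productOp_one]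

/-- **Bytes ⇒ the certificate sentence.**  See the module docstring.  `ψ = mpsOpenVar N A l r`; the `H`-sweep
runs over E1's automaton `graphAutomaton G t U` from the exact boundary family `Pi.single START ((star l) ⊗ l)`,
the `Nrm`-sweep over the identity words from `(star l) ⊗ l`; `hh`/`nh` are the real parts of the numbers read out
of the last environments, `rh`/`rn` the printed radii times the boundary factor `(Σ‖r i‖)²`; the last two
hypotheses are the reader's by-value ACCEPT test (`accept_sound` with `den = 1`). -/
theorem certificate_sentence_of_reader (G : SimpleGraph (Fin N)) [DecidableRel G.Adj] (t U : ℝ)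
    (A : Fin N → MPSTensor 4 D) (l r : Fin D → ℂ)
    (κ : Fin N → ℝ) (hκ0 : ∀ k, 0 ≤ κ k)
    (hκ : ∀ k (z : EuclideanSpace ℂ (Fin D)), ∑ s, ‖toLp 2 (A k s *ᵥ ofLp z)‖ ^ 2 ≤ κ k * ‖z‖ ^ 2)
    -- the `H`-sweep through E1's automaton
    (M : Fin N → HState N → HState N → ℝ) (hM0 : ∀ k b c, 0 ≤ M k b c)
    (hMrow : ∀ k b c s, ∑ s', ‖graphAutomaton G t U k b c s s'‖ ≤ M k b c)
    (hMcol : ∀ k b c s', ∑ s, ‖graphAutomaton G t U k b c s s'‖ ≤ M k b c)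
    (YH : Fin (N + 1) → HState N → Matrix (Fin D) (Fin D) ℂ) (ρH : Fin N → HState N → ℝ)
    (hρH : ∀ (k : Fin N) (c : HState N),
      ‖YH k.succ c - ∑ b, transferOp (A k) (graphAutomaton G t U k b c) (YH k.castSucc b)‖ ≤ ρH k c)
    (radH : Fin (N + 1) → HState N → ℝ)
    (hrH0 : ∀ b, ‖YH 0 b -
      (Pi.single HState.start (vecMulVec (star l) l) : HState N → Matrix (Fin D) (Fin D) ℂ) b‖ ≤ radH 0 b)
    (hrH : ∀ (k : Fin N) (c : HState N), ∑ b, M k b c * κ k * radH k.castSucc b + ρH k c ≤ radH k.succ c)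
    -- the `Nrm`-sweep (identity words)
    (YN : Fin (N + 1) → Matrix (Fin D) (Fin D) ℂ) (ρN : Fin N → ℝ)
    (hρN : ∀ k : Fin N, ‖YN k.succ - transferOp (A k) 1 (YN k.castSucc)‖ ≤ ρN k)
    (radN : Fin (N + 1) → ℝ) (hrN0 : ‖YN 0 - vecMulVec (star l) l‖ ≤ radN 0)
    (hrN : ∀ k : Fin N, 1 * κ k * radN k.castSucc + ρN k ≤ radN k.succ)
    -- the by-value ACCEPT test on the printed numbers
    (E : ℝ)
    (hlo : (star r ⬝ᵥ (YH (Fin.last N) HState.fin *ᵥ r)).re + (∑ i, ‖r i‖) * (∑ i, ‖r i‖) * radH (Fin.last N)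
        HState.fin ≤ E * ((star r ⬝ᵥ (YN (Fin.last N) *ᵥ r)).re - (∑ i, ‖r i‖) * (∑ i, ‖r i‖) * radN (Fin.last N)))
    (hhi : (star r ⬝ᵥ (YH (Fin.last N) HState.fin *ᵥ r)).re + (∑ i, ‖r i‖) * (∑ i, ‖r i‖) * radH (Fin.last N)
        HState.fin ≤ E * ((star r ⬝ᵥ (YN (Fin.last N) *ᵥ r)).re + (∑ i, ‖r i‖) * (∑ i, ‖r i‖) * radN (Fin.last N))) :
    (star (mpsOpenVar N A l r) ⬝ᵥ (toSpin (hamiltonian G t U) *ᵥ mpsOpenVar N A l r)).re ≤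
      E * (star (mpsOpenVar N A l r) ⬝ᵥ mpsOpenVar N A l r).re := by
  -- the `H`-number is enclosed (parts 15 + 12)
  have hH := reader_encloses_hamiltonian_element G t U A κ hκ0 hκ M hM0 hMrow hMcol l l r r YH ρH hρH radH
    hrH0 hrH
  -- the `Nrm`-number is enclosed (part 12, one state, identity words)
  have hNrm := reader_encloses_productOp_element N A (fun _ => (1 : Matrix (Fin 4) (Fin 4) ℂ)) κ hκ0 hκ
    (fun _ => (1 : ℝ)) (fun _ => zero_le_one) (fun _ s => (sum_norm_one_apply_row s).le)
    (fun _ s' => (sum_norm_one_apply_col s').le) (1 : Op (Fin N) 4) one_apply_eq_prod_one l l r r YN ρN hρN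
    radN hrN0 hrN
  rw [Matrix.one_mulVec] at hNrm
  -- real parts, then part 3's by-value soundness with `den = 1`
  have hA := abs_re_sub_re_le_of_norm_sub_le hH
  have hB := abs_re_sub_re_le_of_norm_sub_le hNrm
  rw [← one_mul ((star (mpsOpenVar N A l r) ⬝ᵥ (toSpin (hamiltonian G t U) *ᵥ mpsOpenVar N A l r)).re)] at hA
  rw [← one_mul E] at hlo hhi
  exact accept_sound one_pos hB hA hlo hhi

end Summit.Ventures.CertifiedManyBodySolver.Upper.IntervalReader

end
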